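import Literature.Analysis.Fourier.HilbertTransformCircleEndpoints
import Literature.Analysis.FluidPDE.OkamotoSakajoWunsch2008.AprioriBounds
import HarnessLib

/-!
# OSW separable blow-up, THEOREM E2: the ANALYTIC STEP (origin/antipode identities) typed, and the a-priori window assembled

HONEST FRAMING (cells pub-oswblow / ns-blowup; 1-D MODEL (gCLM/OSW on the circle), computer-assisted context; not Euler/NS):
`Literature/Analysis/FluidPDE/OkamotoSakajoWunsch2008/AprioriBounds.lean` kernel-checks the ARITHMETIC step of LAW.md §4 THEOREM E2
(«(1 − a·m)H₀ = 1, (1 − a·p)Hπ = 1, H₀ > 0 > Hπ ⇒ 1/p < a < 1/m») and records the ANALYTIC step as «not formalised here — it needs the periodic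
Hilbert transform as an operator». With the operator `Literature.Analysis.Fourier.hilbertTransformCircle` now in the tree, the analytic step splits into
(i) two LIMIT identities — dividing the profile equation (T1) `f = −a·g·f′ + f·Hf` by `f` and letting `x → 0⁺`: if `x f′/f → m`, `g(x)/x → H₀` and
`Hf(x) → H₀` then `(1 − a·m)·H₀ = 1` (`origin_identity`; the antipode identity is the same lemma applied to the functions shifted to the antipode,
`antipode_identity`) — pure limits, `H` enters as a function; and (ii) the KERNEL SIGN FACTS `Hf(0) > 0 > Hf(π)` for odd `2π`-periodic `f < 0` on
`(0, π)`, which are `hilbertTransformCircle_zero_pos` / `hilbertTransformCircle_pi_neg` of `HilbertTransformCircleEndpoints.lean`. `apriori_window_of_signs`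
assembles (i)+(ii)+the arithmetic step: every such profile with vanishing orders `m` at `0` and `p` at `π` has `1/p < a < 1/m`. No definition, no named fact;
the vanishing-order and continuity clauses stay explicit hypotheses (they are properties of the certified profiles, discharged per rung elsewhere).
-/

namespace Summit.NavierStokesRegularity.OSWSelfSimilar
namespace OSWAprioriAnalyticStep

open _root_.MeasureTheory Set Filter
open Literature.Analysis.Fourier
open scoped Real Topology

/-- **ORIGIN IDENTITY (limits only).** If on some `(0, δ)` the profile equation `f = −a·g·f′ + f·h` holds with `f ≠ 0`, and as `x → 0⁺`
`x·f′(x)/f(x) → m` (vanishing order), `g(x)/x → H₀` (`g(0) = 0`, `g′(0) = H₀`) and `h(x) → H₀` (`h = Hf` continuous at `0`), then `(1 − a·m)·H₀ = 1`.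
[folklore] -/
theorem origin_identity {a m H₀ δ : ℝ} {f f' g h : ℝ → ℝ} (hδ : 0 < δ)
    (hT1 : ∀ x ∈ Ioo 0 δ, f x = -a * g x * f' x + f x * h x) (hf0 : ∀ x ∈ Ioo 0 δ, f x ≠ 0)
    (hm : Tendsto (fun x => x * f' x / f x) (𝓝[>] 0) (𝓝 m)) (hg : Tendsto (fun x => g x / x) (𝓝[>] 0) (𝓝 H₀))
    (hh : Tendsto h (𝓝[>] 0) (𝓝 H₀)) : (1 - a * m) * H₀ = 1 := by
  have hlim : Tendsto (fun x => -a * (g x / x) * (x * f' x / f x) + h x) (𝓝[>] 0) (𝓝 (-a * H₀ * m + H₀)) :=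
    ((hg.const_mul (-a)).mul hm).add hh
  have heq : ∀ᶠ x in 𝓝[>] (0 : ℝ), (1 : ℝ) = -a * (g x / x) * (x * f' x / f x) + h x := by
    filter_upwards [Ioo_mem_nhdsGT hδ] with x hx
    have hx0 : x ≠ 0 := ne_of_gt hx.1
    have hfx : f x ≠ 0 := hf0 x hx
    have e := hT1 x hx
    field_simp
    linear_combination e
  have h1 : Tendsto (fun _ : ℝ => (1 : ℝ)) (𝓝[>] 0) (𝓝 (-a * H₀ * m + H₀)) := hlim.congr' (heq.mono fun x hx => hx.symm)
  have := tendsto_nhds_unique h1 tendsto_const_nhds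
  linear_combination this

/-- **ANTIPODE IDENTITY** — the same statement read at the antipode: if on `(0, δ)` (in the local variable `y = x − π`) the shifted equation
`F = −a·G·F′ + F·hπ` holds with `F ≠ 0`, `y·F′(y)/F(y) → p`, `G(y)/y → Hπ` (`g(π) = 0`) and `hπ(y) → Hπ`, then `(1 − a·p)·Hπ = 1`. [folklore] -/
theorem antipode_identity {a p Hπ δ : ℝ} {F F' G hπ : ℝ → ℝ} (hδ : 0 < δ)
    (hT1 : ∀ y ∈ Ioo 0 δ, F y = -a * G y * F' y + F y * hπ y) (hF0 : ∀ y ∈ Ioo 0 δ, F y ≠ 0)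
    (hp : Tendsto (fun y => y * F' y / F y) (𝓝[>] 0) (𝓝 p)) (hG : Tendsto (fun y => G y / y) (𝓝[>] 0) (𝓝 Hπ))
    (hh : Tendsto hπ (𝓝[>] 0) (𝓝 Hπ)) : (1 - a * p) * Hπ = 1 :=
  origin_identity hδ hT1 hF0 hp hG hh

/-- **THEOREM E2 assembled against the analytic operator.** Let `f` be odd, `2π`-periodic and negative on `(0, π)`, with the kernels `f·cot(·/2)` and
`f·tan(·/2)` interval-integrable on `[0, π]`, and let `H₀ := Hf(0)`, `Hπ := Hf(π)` for `H = hilbertTransformCircle`. If the two limit identities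
`(1 − a·m)·H₀ = 1`, `(1 − a·p)·Hπ = 1` hold (from `origin_identity` / `antipode_identity`) with vanishing orders `m, p > 0`, then `1/p < a < 1/m`.
(The signs `H₀ > 0 > Hπ` are supplied by the kernel representations.) [folklore] -/
theorem apriori_window_of_signs {f : ℝ → ℝ} {a m p : ℝ} (hodd : ∀ y, f (-y) = -f y) (hper : ∀ y, f (y + 2 * π) = f y)
    (hneg : ∀ y ∈ Ioo (0 : ℝ) π, f y < 0)
    (hint0 : IntervalIntegrable (fun y => f y * (Real.cos (y / 2) / Real.sin (y / 2))) volume 0 π)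
    (hintπ : IntervalIntegrable (fun y => f y * (Real.sin (y / 2) / Real.cos (y / 2))) volume 0 π)
    (h0 : (1 - a * m) * hilbertTransformCircle f 0 = 1) (hπ : (1 - a * p) * hilbertTransformCircle f π = 1)
    (hm : 0 < m) (hp : 0 < p) : 1 / p < a ∧ a < 1 / m :=
  Literature.Analysis.FluidPDE.OkamotoSakajoWunsch2008.AprioriBounds.apriori_window h0 hπ
    (hilbertTransformCircle_zero_pos hodd hneg hint0) (hilbertTransformCircle_pi_neg hodd hper hneg hintπ) hm hp

end OSWAprioriAnalyticStep
end Summit.NavierStokesRegularity.OSWSelfSimilar
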